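import Mathlib
import Summits.CriticalPhenomena.PercolationContinuityZ3.Theorems.PercNearOneGluingNoHeavyQuantTwoArcSunData
import HarnessLib

/-!
# QUANT lane R8, "FAR beyond trees", layer one on hairy cycles — **`SunFAR K 1` ON THE SURE-ARGMIN REGION** (bridge, part 2: the assembly)

builds on p205010 (kernel theorem, internal audit signed; external expert review pending)

Support file (`--supports stmt-CriticalPhenomena-4575`), seat `prim-quant-p1` (gen 17); memos `quant/prim-quant-p1-g16/FOR-LEAD-TWOCHAIN-A.md` §6′,
`quant/prim-quant-p1-g17/FOR-LEAD-TWOCHAIN-B.md` §2–§3, `FOR-PROVERS-TWOARC-BRIDGE.md`; law side by prim-cert-1 g20 (INBOX 23:28Z/23:42Z).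
* `G2 K g T = sunLaw K g 1 (2 ≤ #(T ∩ ·))` — the hair-free law of "at least two of the positions `T` joined to `o`";
* `sunLaw_two_le_eq_expect2` — **(D0)**: with `h a = 1`, `sunLaw K g h (2 ≤ #·)` is the two-sided `expect2` of `G2` over the companion hair patterns
  (prim-cert-1's `sunLaw_eq_sum_hairW_mul_one` + `hairW = patW (range K)` + `sum_patW_range_eq_expect2`);
* **`sunMarg_le_sunLaw_two_le_of_sure`** — THE TWO-ARC LEMMA ON THE SUN (TC-MC regime A, sure least-likely tip, every `K ≥ 2`, every position):
  `g, h ∈ [0,1]`, `a < K`, `h a = 1`, `sunMarg a ≤ sunMarg b` for all tips `b`, `Σ_{b ≠ a} sunMarg b ≥ 1` ⟹ `sunMarg K g h a ≤ sunLaw K g h (2 ≤ #·)`.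
  PROOF: `expect2_nonneg` (`…QuantTwoArcExpect`) applied to the guarded integrand `Ψ(Q_L,Q_R) = G2 (insert a …) − x`; its hypotheses are: the
  identity (D0); admissibility and orderings of the companion data from the monotone arcs; the companion mass; the small-pattern values
  (D1) `G2 {a} = 0`, (D2) singletons `−A_b c_b`, (D3) same-side pairs `d_j + A_j(c_j − c_k)`, (D4) mixed pairs `(α_{j+1} − α_{a+1})(β_{k+1} − β_{a+1})`
  — all `ring` after prim-cert-1's arc sums and `α_m β_m = c` — and (D5) `Ψ ≥ 0` beyond two open companion hairs by the middle-position lemma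
  `sunMarg_le_sunLaw_one_two_le_card` and the least-likely hypothesis;
* **`sunFAR_one_of_sure_argmin`** — `SunFAR K 1`'s conclusion (`sunLaw K g h (# ≤ 1) ≤ t` whenever `2 < Σ sunMarg` and `1 − sunMarg k ≤ t ∀k`) for EVERY
  weight configuration in which some least-likely tip has a sure hair (`h a = 1`).  With `HairyCycle.farRelayRow_hairyCycle_of_sunFAR`-type bridges this is
  FAR at layer one on every hairy cycle / ring whose least-likely relay is (glued to) a cycle vertex; the complement — least-likely tip tied with another tip,
  both hairs `< 1` — is the open "tied-random" case (memo §5).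
No sorries; standard axioms. [this work]
-/

namespace Summit.CriticalPhenomena.PercolationContinuityZ3.Theorems

namespace Quant

namespace TwoArc

open Finset
open Summit.CriticalPhenomena.PercolationContinuityZ3.Theorems.HairyCycle

/-! ## The assembly: `SunFAR K 1`'s conclusion for a SURE least-likely tip -/

section assembly

variable {K : ℕ} (hK : 2 ≤ K) {g h : ℕ → ℝ} (hg : ∀ m, m ≤ K → 0 ≤ g m ∧ g m ≤ 1) (hh : ∀ k, k < K → 0 ≤ h k ∧ h k ≤ 1)
  {a : ℕ} (ha : a < K) (hha : h a = 1) (hmin : ∀ b, b < K → sunMarg K g h a ≤ sunMarg K g h b)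

/-- The hair-free law of "at least two of the positions of `T` are joined to `o`". [this work] -/
noncomputable def G2 (K : ℕ) (g : ℕ → ℝ) (T : Finset ℕ) : ℝ := sunLaw K g (fun _ => (1 : ℝ)) (fun R => 2 ≤ (T ∩ R).card)

/-- prim-cert-1's `hairW` is `patW (range K)`. [this work] -/
theorem hairW_eq_patW (h : ℕ → ℝ) (Q : Finset ℕ) : hairW K h Q = patW (Finset.range K) h Q := rfl

include ha hha in
/-- **(D0)**: with `h a = 1`, `sunLaw K g h (2 ≤ #·)` is the two-sided expectation of `G2` over the companion hair patterns. [this work] -/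
theorem sunLaw_two_le_eq_expect2 :
    sunLaw K g h (fun R => 2 ≤ R.card) =
      expect2 (sfL K g h a) (sfR K g h a) (leftIdx a) (rightIdx K a) (fun QL QR => G2 K g (insert a (QL ++ QR).toFinset)) := by
  rw [sunLaw_eq_sum_hairW_mul_one]
  simp only [hairW_eq_patW]
  exact sum_patW_range_eq_expect2 ha h hha (fun Q => G2 K g Q) (sfL K g h a) (sfR K g h a) (fun _ _ => rfl) (fun _ _ => rfl)

include hK hg hh ha hha hmin in
/-- **THE TWO-ARC LEMMA ON THE SUN, SURE LEAST-LIKELY TIP** (TC-MC regime A, kernel; p1 g16 §6′ + p1 g17 memo §2–§3 + prim-cert-1's sun-law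
dictionary): for cycle weights `g` and hair weights `h` in `[0,1]`, a tip `a` with `h a = 1` whose marginal is least, and companions of total
marginal `≥ 1`:  `P(o ↔ t_a) ≤ P(# reached tips ≥ 2)`, i.e. `sunMarg K g h a ≤ sunLaw K g h (2 ≤ #·)`. [this work] -/
theorem sunMarg_le_sunLaw_two_le_of_sure (hσ : 1 ≤ ∑ b ∈ (Finset.range K).erase a, sunMarg K g h b) :
    sunMarg K g h a ≤ sunLaw K g h (fun R => 2 ≤ R.card) := by
  classical
  -- notation
  obtain ⟨hnd, hset⟩ := leftIdx_append_rightIdx (K := K) ha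
  set pL := spL K g a with hpL
  set pR := spR g a with hpR
  set L := leftIdx a with hLdef
  set R := rightIdx K a with hRdef
  set x := sunMarg K g h a with hx
  have hx' : xv pL pR = x := xv_spL_spR ha hha
  have hαa := arcA_mem hg (i := a + 1) (by omega); have hβa := arcB_mem hg (K := K) (a + 1)
  have hca := arcA_mul_arcB (K := K) (g := g) (m := a + 1) (by omega)
  -- membership facts
  have memL : ∀ {b}, b ∈ L → b < a := fun hb => by simpa [hLdef, leftIdx] using hb
  have memR : ∀ {b}, b ∈ R → a < b ∧ b < K := fun hb => by
    simp only [hRdef, rightIdx, List.mem_range'_1] at hb; omega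
  -- the guarded integrand
  let Ψ : List ℕ → List ℕ → ℝ := fun QL QR =>
    if QL.Sublist L ∧ QR.Sublist R then G2 K g (insert a (QL ++ QR).toFinset) - x else 0
  -- (1) the identity  sunLaw(2 ≤ #) − x = expect2 Ψ
  have hid : sunLaw K g h (fun R => 2 ≤ R.card) - x = expect2 (sfL K g h a) (sfR K g h a) L R Ψ := by
    rw [sunLaw_two_le_eq_expect2 ha hha]
    unfold expect2
    rw [← expect_sub_const]
    refine expect_congr_sublist _ fun QL hQL => ?_
    rw [← expect_sub_const]
    refine expect_congr_sublist _ fun QR hQR => ?_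
    have hc : QL.Sublist L ∧ QR.Sublist R := ⟨hQL, hQR⟩
    simp only [Ψ, if_pos hc]
  -- (2) admissibility of the companion data
  have admL : ∀ b ∈ L, HComp.Adm pL pR (sfL K g h a b) := fun b hb => by
    have hb := memL hb
    have hα := arcA_mem hg (i := b + 1) (by omega); have hβ := arcB_mem hg (K := K) (b + 1)
    have hαle := arcA_anti hg (i := b + 1) (j := a + 1) (by omega) (by omega)
    have hβle := arcB_mono hg (i := b + 1) (j := a + 1) (by omega) (by omega)
    exact { A_nonneg := by simp only [sfL]; linarith
            A_le := by simp only [sfL, hpL, spL]; linarith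
            c_nonneg := by simp only [sfL]; linarith
            c_le := by simp only [sfL, hpR, spR]; linarith
            h_nonneg := (hh b (by omega)).1
            h_le := (hh b (by omega)).2
            x_le_T := by rw [hx', sfL_T b (by omega)]; exact hmin b (by omega) }
  have admR : ∀ b ∈ R, HComp.Adm pR pL (sfR K g h a b) := fun b hb => by
    have hb := memR hb
    have hα := arcA_mem hg (i := b + 1) (by omega); have hβ := arcB_mem hg (K := K) (b + 1)
    have hαle := arcA_anti hg (i := a + 1) (j := b + 1) (by omega) (by omega)
    have hβle := arcB_mono hg (i := a + 1) (j := b + 1) (by omega) (by omega)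
    exact { A_nonneg := by simp only [sfR]; linarith
            A_le := by simp only [sfR, hpR, spR]; linarith
            c_nonneg := by simp only [sfR]; linarith
            c_le := by simp only [sfR, hpL, spL]; linarith
            h_nonneg := (hh b (by omega)).1
            h_le := (hh b (by omega)).2
            x_le_T := by rw [xv_comm, hx', sfR_T b (by omega)]; exact hmin b (by omega) }
  -- (3) orderings
  have hpwL : L.Pairwise (fun j j' => j' < j) := by
    simpa [hLdef, leftIdx, List.pairwise_reverse] using (List.pairwise_lt_range (n := a))
  have hpwR : R.Pairwise (fun k k' => k < k' ∧ k' < K) := by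
    have h1 : R.Pairwise (fun k k' => k < k') := by
      simpa [hRdef, rightIdx] using (List.pairwise_lt_range' (s := a + 1) (n := K - 1 - a))
    exact h1.imp_of_mem fun {k k'} hk hk' hlt => ⟨hlt, (memR hk').2⟩
  have hAL : L.Pairwise (fun j k => (sfL K g h a j).A ≤ (sfL K g h a k).A) :=
    hpwL.imp_of_mem fun {j j'} hj hj' hlt => by
      have := arcB_mono hg (i := j' + 1) (j := j + 1) (by omega) (by have := memL hj; omega)
      simp only [sfL]; linarith
  have hcL : L.Pairwise (fun j k => (sfL K g h a k).c ≤ (sfL K g h a j).c) :=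
    hpwL.imp_of_mem fun {j j'} hj hj' hlt => by
      have := arcA_anti hg (i := j' + 1) (j := j + 1) (by omega) (by have := memL hj; omega)
      simp only [sfL]; linarith
  have hAR : R.Pairwise (fun j k => (sfR K g h a j).A ≤ (sfR K g h a k).A) :=
    hpwR.imp fun {k k'} hkk => by
      have := arcA_anti hg (i := k + 1) (j := k' + 1) (by omega) (by omega)
      simp only [sfR]; linarith
  have hcR : R.Pairwise (fun j k => (sfR K g h a k).c ≤ (sfR K g h a j).c) :=
    hpwR.imp fun {k k'} hkk => by
      have := arcB_mono hg (i := k + 1) (j := k' + 1) (by omega) (by omega)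
      simp only [sfR]; linarith
  -- (4) total companion mass
  have hσ' : 1 ≤ sigW pL (L.map (sfL K g h a)) + sigW pR (R.map (sfR K g h a)) := by
    have eL : sigW pL (L.map (sfL K g h a)) = (L.map (sunMarg K g h)).sum := by
      simp only [sigW, List.map_map]
      exact congrArg List.sum (List.map_congr_left fun b hb => sfL_T b (by have := memL hb; omega))
    have eR : sigW pR (R.map (sfR K g h a)) = (R.map (sunMarg K g h)).sum := by
      simp only [sigW, List.map_map]
      exact congrArg List.sum (List.map_congr_left fun b hb => sfR_T b (memR hb).2)
    rw [eL, eR, ← List.sum_append, ← List.map_append, ← List.sum_toFinset _ hnd, hset]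
    exact hσ
  -- (5) the values of Ψ on small patterns
  have hG1 : G2 K g ({a} : Finset ℕ) = 0 := sunLaw_one_single a
  have h00 : Ψ [] [] = -xv pL pR := by
    simp only [Ψ, List.nil_sublist, and_self, if_true, List.append_nil, List.toFinset_nil, Finset.insert_empty, hG1, hx']
    ring
  have hL1 : ∀ j ∈ L, Ψ [j] [] = -((sfL K g h a j).A * (sfL K g h a j).c) := fun j hj => by
    have hja := memL hj
    have hcj := arcA_mul_arcB (K := K) (g := g) (m := j + 1) (by omega)
    have hG : G2 K g (insert a ([j] ++ []).toFinset)
        = arcA g (a + 1) + arcB K g (j + 1) + arcA g (j + 1) * arcB K g (a + 1) - 2 * arcA g (K + 1) := by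
      rw [← sunLaw_one_two_pair hK hg hja ha]
      simp only [G2, List.append_nil, List.toFinset_cons, List.toFinset_nil, Finset.insert_empty]
      rw [Finset.pair_comm]
    simp only [Ψ, List.singleton_sublist.2 hj, List.nil_sublist, and_self, if_true, hG, hx, sunMarg, hha, one_mul, sfL]
    linear_combination hcj
  have hR1 : ∀ k ∈ R, Ψ [] [k] = -((sfR K g h a k).A * (sfR K g h a k).c) := fun k hk => by
    have hak := memR hk
    have hck := arcA_mul_arcB (K := K) (g := g) (m := k + 1) (by omega)
    have hG : G2 K g (insert a ([] ++ [k]).toFinset)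
        = arcA g (k + 1) + arcB K g (a + 1) + arcA g (a + 1) * arcB K g (k + 1) - 2 * arcA g (K + 1) := by
      rw [← sunLaw_one_two_pair hK hg hak.1 hak.2]
      simp only [G2, List.nil_append, List.toFinset_cons, List.toFinset_nil, Finset.insert_empty]
    simp only [Ψ, List.singleton_sublist.2 hk, List.nil_sublist, and_self, if_true, hG, hx, sunMarg, hha, one_mul, sfR]
    linear_combination hck
  have hL2 : L.Pairwise (fun j j' => Ψ [j, j'] [] = Comp.phi pL pR ((sfL K g h a j).toComp pL) ((sfL K g h a j').toComp pL)) := by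
    refine (hpwL.and (pairwise_pair_sublist L)).imp_of_mem fun {j j'} hj hj' hboth => ?_
    obtain ⟨hlt, hsub⟩ := hboth
    have hja := memL hj
    have hG : G2 K g (insert a ([j, j'] ++ []).toFinset) = _ :=
      (congrArg (G2 K g) (by
        simp only [List.append_nil, List.toFinset_cons, List.toFinset_nil, Finset.insert_empty]
        ext y; simp only [Finset.mem_insert, Finset.mem_singleton]; omega)).trans
        (sunLaw_one_two_triple hK hg hlt hja ha (u := j') (v := j) (w := a))
    simp only [Ψ, hsub, List.nil_sublist, and_self, if_true, hG, hx, sunMarg, hha, one_mul, Comp.phi, Comp.d, HComp.toComp, sfL,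
      hpL, hpR, spL, spR]
    linear_combination (-1 : ℝ) * hca
  have hR2 : R.Pairwise (fun k k' => Ψ [] [k, k'] = Comp.phi pR pL ((sfR K g h a k).toComp pR) ((sfR K g h a k').toComp pR)) := by
    refine (hpwR.and (pairwise_pair_sublist R)).imp_of_mem fun {k k'} hk hk' hboth => ?_
    obtain ⟨⟨hlt, hk'K⟩, hsub⟩ := hboth
    have hak := (memR hk).1
    have hG : G2 K g (insert a ([] ++ [k, k']).toFinset) = _ :=
      (congrArg (G2 K g) (by
        simp only [List.nil_append, List.toFinset_cons, List.toFinset_nil, Finset.insert_empty])).trans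
        (sunLaw_one_two_triple hK hg hak hlt hk'K (u := a) (v := k) (w := k'))
    simp only [Ψ, hsub, List.nil_sublist, and_self, if_true, hG, hx, sunMarg, hha, one_mul, Comp.phi, Comp.d, HComp.toComp, sfR,
      hpL, hpR, spL, spR]
    linear_combination (-1 : ℝ) * hca
  have hX : ∀ j ∈ L, ∀ k ∈ R, Ψ [j] [k] = (pR - (sfL K g h a j).c) * (pL - (sfR K g h a k).c) := fun j hj k hk => by
    have hja := memL hj; have hak := memR hk
    have hG : G2 K g (insert a ([j] ++ [k]).toFinset) = _ :=
      (congrArg (G2 K g) (by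
        simp only [List.singleton_append, List.toFinset_cons, List.toFinset_nil, Finset.insert_empty]
        ext y; simp only [Finset.mem_insert, Finset.mem_singleton]; omega)).trans
        (sunLaw_one_two_triple hK hg hja hak.1 hak.2 (u := j) (v := a) (w := k))
    simp only [Ψ, List.singleton_sublist.2 hj, List.singleton_sublist.2 hk, and_self, if_true, hG, hx, sunMarg, hha, one_mul, sfL,
      sfR, hpL, hpR, spL, spR]
    linear_combination (-1 : ℝ) * hca
  -- (6) positivity beyond two open companion hairs: the middle position
  have h3 : ∀ QL QR : List ℕ, 3 ≤ QL.length + QR.length → 0 ≤ Ψ QL QR := fun QL QR hlen => by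
    by_cases hg' : QL.Sublist L ∧ QR.Sublist R
    swap
    · simp only [Ψ, if_neg hg']; exact le_rfl
    simp only [Ψ, if_pos hg']
    obtain ⟨hQL, hQR⟩ := hg'
    have hsub : (QL ++ QR).Sublist (L ++ R) := hQL.append hQR
    have hnd' : (QL ++ QR).Nodup := hsub.nodup hnd
    set S := (QL ++ QR).toFinset with hS
    have hSsub : S ⊆ (Finset.range K).erase a := by
      rw [← hset]; intro y hy; exact List.mem_toFinset.2 (hsub.subset (List.mem_toFinset.1 hy))
    have haS : a ∉ S := fun h => by simpa using hSsub h
    have hcardS : S.card = QL.length + QR.length := by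
      rw [hS, List.toFinset_card_of_nodup hnd', List.length_append]
    set T := insert a S with hT
    have hTsub : T ⊆ Finset.range K := by
      intro y hy
      rcases Finset.mem_insert.1 hy with rfl | hy
      · exact Finset.mem_range.2 ha
      · exact Finset.mem_of_mem_erase (hSsub hy)
    have hcardT : 3 ≤ T.card := by rw [hT, Finset.card_insert_of_notMem haS, hcardS]; omega
    -- three ordered elements j < m < m'
    have hTne : T.Nonempty := Finset.card_pos.1 (by omega)
    set j := T.min' hTne with hj
    set m' := T.max' hTne with hm'
    have hjT : j ∈ T := Finset.min'_mem _ _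
    have hm'T : m' ∈ T := Finset.max'_mem _ _
    have hrest : ((T.erase j).erase m').Nonempty := by
      apply Finset.card_pos.1
      have h1 := Finset.card_erase_of_mem hjT
      have h2 : m' ∈ T.erase j := by
        refine Finset.mem_erase.2 ⟨?_, hm'T⟩
        intro heq
        have : T.card ≤ 1 := by
          rw [← Finset.card_singleton j]
          refine Finset.card_le_card fun y hy => ?_
          have h1 := Finset.min'_le T y hy; have h2 := Finset.le_max' T y hy
          rw [← hj] at h1; rw [← hm', heq] at h2
          exact Finset.mem_singleton.2 (le_antisymm h2 h1)
        omega
      have h3 := Finset.card_erase_of_mem h2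
      omega
    obtain ⟨m, hm⟩ := hrest
    have hmT : m ∈ T := Finset.mem_of_mem_erase (Finset.mem_of_mem_erase hm)
    have hmj : m ≠ j := Finset.ne_of_mem_erase (Finset.mem_of_mem_erase hm)
    have hmm' : m ≠ m' := Finset.ne_of_mem_erase hm
    have hjm : j < m := lt_of_le_of_ne (by rw [hj]; exact Finset.min'_le T m hmT) hmj.symm
    have hmm'' : m < m' := lt_of_le_of_ne (by rw [hm']; exact Finset.le_max' T m hmT) hmm'
    have hmK : m < K := Finset.mem_range.1 (hTsub hmT)
    have hS3 := sunMarg_le_sunLaw_one_two_le_card hK hg hTsub hjT hmT hm'T hjm hmm''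
    -- sunMarg K g 1 m ≥ sunMarg K g h m ≥ x
    have hone : sunMarg K g h m ≤ sunMarg K g (fun _ => (1 : ℝ)) m := by
      have hnn : 0 ≤ sunMarg K g (fun _ => (1 : ℝ)) m := by
        rw [← sunLaw_mem_eq_sunMarg hK hg (fun _ _ => ⟨zero_le_one, le_rfl⟩) hmK]
        exact sunLaw_nonneg hK hg (fun _ _ => ⟨zero_le_one, le_rfl⟩) _
      have hm1 := hh m hmK
      simp only [sunMarg, one_mul] at hnn ⊢
      nlinarith
    have := hmin m hmK
    simp only [G2, ge_iff_le]
    linarith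
  -- (7) conclude
  have hnn := expect2_nonneg pL pR (by simp only [hpL, spL]; linarith [hβa.2]) (by simp only [hpL, spL]; linarith [hβa.1])
    (by simp only [hpR, spR]; linarith [hαa.2]) (by simp only [hpR, spR]; linarith [hαa.1])
    (sfL K g h a) (sfR K g h a) L R ?_ admL admR hAL hcL hAR hcR hσ' h00 hL1 hR1 hL2 hR2 hX h3
  · linarith [hid]
  · -- at least one companion: K ≥ 2
    by_cases hL0 : L = []
    · right
      intro hR0
      have : ((Finset.range K).erase a).card = 0 := by
        rw [← hset, hL0, hR0]; simp
      rw [Finset.card_erase_of_mem (Finset.mem_range.2 ha), Finset.card_range] at this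
      omega
    · left; exact hL0

include hK hg hh in
/-- **`SunFAR K 1` ON THE SURE-ARGMIN REGION**: the law-level FAR row at layer one holds for every weight configuration of the sun graph with `K` hairs in
which some least-likely tip has a sure hair.  (The remaining configurations — the least-likely tip tied with another tip, both hairs `< 1` — are the
open "tied-random" case of memo §5.) [this work] -/
theorem sunFAR_one_of_sure_argmin (hsum : (2 : ℝ) < ∑ k ∈ Finset.range K, sunMarg K g h k)
    (hex : ∃ a, a < K ∧ h a = 1 ∧ ∀ b, b < K → sunMarg K g h a ≤ sunMarg K g h b)
    (t : ℝ) (ht : ∀ k, k < K → 1 - sunMarg K g h k ≤ t) :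
    sunLaw K g h (fun R => R.card ≤ 1) ≤ t := by
  obtain ⟨a, ha, hha, hmin⟩ := hex
  have hxa : sunMarg K g h a ≤ 1 := by
    rw [← sunLaw_mem_eq_sunMarg hK hg hh ha]; exact sunLaw_le_one hK hg hh _
  have hσ : 1 ≤ ∑ b ∈ (Finset.range K).erase a, sunMarg K g h b := by
    have := Finset.sum_erase_add (Finset.range K) (sunMarg K g h) (Finset.mem_range.2 ha)
    linarith
  have hmain := sunMarg_le_sunLaw_two_le_of_sure hK hg hh ha hha hmin hσ
  have htail := sunLaw_card_ge_eq hK hg hh 1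
  have := ht a ha
  rw [show (fun R : Finset ℕ => 1 + 1 ≤ R.card) = (fun R => 2 ≤ R.card) from rfl] at htail
  linarith

end assembly

end TwoArc

end Quant

end Summit.CriticalPhenomena.PercolationContinuityZ3.Theorems
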